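import Summits.AtomisticToContinuum.Crystallization.Theorems.FrustratedLawDichotomyStrainedPatchHomLeafTableSoundA

/-!
# v2 leaf checker — soundness, part B: far labels, treated-label facts, one gradient class (critic row 806 (2)(C))

decomp-a2c hand-1 g20 (crux `AperiodicFrustratedLawGap`, stmt-AtomisticToContinuum-27623).  `far_of_farB` (a label with `81·SC ≤ 4(q0 − r)` is far for
every deformation with Gram data in the box), `treated_facts`, `farB_of_untreated`, `visited_sublist`, `absDiff_cast`, `min_max_band`, and ★ `class_bound`
(the interval-sum-BEFORE-abs bound of one gradient class from the accumulator identity and the class-sum bound).  0 sorry; standard axioms.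
`--supports stmt-AtomisticToContinuum-27623`.
-/

noncomputable section

namespace Summit.AtomisticToContinuum.Crystallization.Theorems.FrustratedLawDichotomyStrainedPatchHomLeafTableCheck

open scoped BigOperators RealInnerProductSpace
open Set
open Literature.Analysis.ValidatedNumerics.Numerics
open Summit.AtomisticToContinuum.Crystallization.Theorems.ChargedEnergyGapNegative (E3)
open Summit.AtomisticToContinuum.Crystallization.Theorems.FrustratedLawDichotomySchurCut (effPot w₄₅ ω₄)
open Summit.AtomisticToContinuum.Crystallization.Theorems.FrustratedLawDichotomyStrainedPatchHomSplit (latPt)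
open Summit.AtomisticToContinuum.Crystallization.Theorems.FrustratedLawDichotomyStrainedPatchHomCentredForm (linear_mem_Icc_of_box)
open Summit.AtomisticToContinuum.Crystallization.Theorems.FrustratedLawDichotomyStrainedPatchHomGram (summand_eq_gram norm_sq_latPt_eq_sum_gram)
open Summit.AtomisticToContinuum.Crystallization.Theorems.FrustratedLawDichotomyStrainedPatchHomTermCalculus (hasDerivAt_phi45 effPot45_eq_far)
open Summit.AtomisticToContinuum.Crystallization.Theorems.FrustratedLawDichotomyStrainedPatchHomLeafPoints

/-! ## §4. Small lemmas for the assembly -/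

/-- The visited prefix is a sublist. [formal bookkeeping] -/
theorem visited_sublist (nstop : ℕ) : ∀ (ls : List NL), (visited nstop ls).Sublist ls
  | [] => List.Sublist.slnil
  | l :: ls => by
    unfold visited
    cases Nat.ble nstop l.n
    · exact (visited_sublist nstop ls).cons_cons l
    · exact List.nil_sublist _

/-- `absDiff` is the absolute difference. [formal bookkeeping] -/
theorem absDiff_cast (p n : ℕ) : ((absDiff p n : ℕ) : ℤ) = |(p : ℤ) - n| := by
  unfold absDiff
  cases h : Nat.ble n p
  · have h' : ¬ n ≤ p := fun hle => by rw [Nat.ble_eq_true_of_le hle] at h; exact Bool.noConfusion h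
    have hlt : p < n := Nat.lt_of_not_le h'
    simp only [Nat.sub_eq]
    rw [Nat.cast_sub hlt.le, abs_of_neg (by exact_mod_cast (show (p:ℤ) - n < 0 by omega))]
    ring
  · have hle : n ≤ p := Nat.le_of_ble_eq_true h
    simp only [Nat.sub_eq]
    rw [Nat.cast_sub hle, abs_of_nonneg (by exact_mod_cast (show (0:ℤ) ≤ (p:ℤ) - n by omega))]

/-- `min ((D−E)L) ((D+E)L) = D·L − E·|L|` and `max … = D·L + E·|L|` for `E ≥ 0`. [folklore] -/
theorem min_max_band (D E L : ℝ) (hE : 0 ≤ E) :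
    min ((D - E) * L) ((D + E) * L) = D * L - E * |L| ∧ max ((D - E) * L) ((D + E) * L) = D * L + E * |L| := by
  rcases le_or_gt 0 L with hL | hL
  · rw [abs_of_nonneg hL]
    have h1 : (D - E) * L ≤ (D + E) * L := mul_le_mul_of_nonneg_right (by linarith) hL
    rw [min_eq_left h1, max_eq_right h1]; constructor <;> ring
  · rw [abs_of_neg hL]
    have h1 : (D + E) * L ≤ (D - E) * L := mul_le_mul_of_nonpos_right (by linarith) hL.le
    rw [min_eq_right h1, max_eq_left h1]; constructor <;> ring

/-- A passing untreated label is far: `farB = true`, with `rad ≤ q0N` and `qNeg ≤ qPos`. [formal bookkeeping] -/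
theorem farB_of_untreated {tab : QT} {k : LK} {l : NL} (hs : stepOK tab k l = true) (ht : treated tab k l = false) :
    qNeg k l + rad k l ≤ qPos k l ∧ farB k l = true := by
  unfold stepOK at hs; unfold treated at ht
  simp only [Bool.and_eq_true, Nat.ble_eq, Bool.or_eq_true] at hs
  obtain ⟨h1, h2⟩ := hs
  refine ⟨h1, ?_⟩
  cases hf : farB k l
  · rw [hf] at ht h2
    simp only [Nat.ble_eq_true_of_le h1, Bool.not_false, Bool.true_and, Bool.false_eq_true, false_or] at ht h2
    rw [h2] at ht; exact absurd ht (by simp)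
  · rfl

/-- A treated label's arithmetic facts: `qNeg + rad ≤ qPos`, the range test of its row, and the row is certified. [formal bookkeeping] -/
theorem treated_facts {tab : QT} {E : ℕ} (htab : tab.allOK E = true) {k : LK} {l : NL} (ht : treated tab k l = true) :
    qNeg k l + rad k l ≤ qPos k l ∧ (rowT tab k l).A ≤ q0N k l - rad k l ∧ q0N k l + rad k l ≤ (rowT tab k l).B ∧
      (rowT tab k l).t ≤ q0N k l ∧ (rowT tab k l).ok E = true := by
  obtain ⟨h1, -, row, hr, hrange⟩ := rowOf_of_treated ht
  have hrow : rowT tab k l = row := by unfold rowT; rw [hr]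
  rw [hrow]
  unfold rangeB at hrange
  simp only [Bool.and_eq_true, Nat.ble_eq] at hrange
  exact ⟨Nat.le_of_ble_eq_true h1, hrange.1.1, hrange.1.2, hrange.2, QT.findLE_none_ok htab hr⟩

/-- The box-7 label set in `Finset` form (as in `…HomLeafPoints`). -/
theorem mem_box7_iff (b : Fin 3 → ℤ) : b ∈ (Fintype.piFinset fun _ : Fin 3 => Finset.Icc (-7 : ℤ) 7).filter (fun b => b ≠ 0) ↔
    (∀ i, -7 ≤ b i ∧ b i ≤ 7) ∧ b ≠ 0 := by
  simp only [Finset.mem_filter, Fintype.mem_piFinset, Finset.mem_Icc]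

/-- FAR BY THE BOX: for a label with `81·SC ≤ 4·(q0 − r)` every deformation with Gram data in the box has `‖latPt G f b‖ ≥ 9/2`. [folklore] -/
theorem far_of_farB {k : LK} {g : GB} (hk : k = g.toLK) {l : NL} (hl : l.ok = true) (h1 : qNeg k l + rad k l ≤ qPos k l)
    (hfar : farB k l = true) (f : Fin 3 → E3) (G : E3 →L[ℝ] E3)
    (hbox : ∀ i j : Fin 3, |⟪G (f i), G (f j)⟫ - ((g.cz i j : ℤ) : ℝ) / SC| ≤ ((g.wz i j : ℤ) : ℝ) / SC) :
    9 / 2 ≤ ‖latPt G f l.toLab‖ := by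
  subst hk
  have hS := SC_pos
  -- the box range lower end in real terms
  have hlin := linear_mem_Icc_of_box
    (fun k9 : Fin 9 => ((l.toLab ((@finProdFinEquiv 3 3).symm k9).1 : ℝ) * (l.toLab ((@finProdFinEquiv 3 3).symm k9).2 : ℝ)))
    (fun k9 => ⟪G (f ((@finProdFinEquiv 3 3).symm k9).1), G (f ((@finProdFinEquiv 3 3).symm k9).2)⟫)
    (fun k9 => ((g.cz ((@finProdFinEquiv 3 3).symm k9).1 ((@finProdFinEquiv 3 3).symm k9).2 : ℤ) : ℝ) / SC)
    (fun k9 => ((g.wz ((@finProdFinEquiv 3 3).symm k9).1 ((@finProdFinEquiv 3 3).symm k9).2 : ℤ) : ℝ) / SC)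
    (fun k9 => hbox _ _)
  rw [ell0_eq hl g, rad_real_eq hl g] at hlin
  have hsq : ‖latPt G f l.toLab‖ ^ 2 =
      ∑ k9 : Fin 9, ((l.toLab ((@finProdFinEquiv 3 3).symm k9).1 : ℝ) * (l.toLab ((@finProdFinEquiv 3 3).symm k9).2 : ℝ)) *
        ⟪G (f ((@finProdFinEquiv 3 3).symm k9).1), G (f ((@finProdFinEquiv 3 3).symm k9).2)⟫ := by
    rw [norm_sq_latPt_eq_sum_gram, ← sum_fin9 (fun i j => ((l.toLab i : ℝ) * (l.toLab j : ℝ)) * ⟪G (f i), G (f j)⟫)]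
  -- the integer far test in real terms
  have hq : (qNeg g.toLK l : ℕ) ≤ qPos g.toLK l := le_trans (Nat.le_add_right _ _) h1
  unfold farB q0N at hfar
  have hfar' : 81 * SCN ≤ 4 * (qPos g.toLK l - qNeg g.toLK l - rad g.toLK l) := by simpa [Nat.ble_eq, Nat.mul_eq] using hfar
  have hsub : rad g.toLK l ≤ qPos g.toLK l - qNeg g.toLK l := by omega
  have hR : (81 : ℝ) / 4 ≤ ((((qPos g.toLK l : ℕ) : ℤ) - ((qNeg g.toLK l : ℕ) : ℤ) : ℤ) : ℝ) / SC - (((rad g.toLK l : ℕ) : ℤ) : ℝ) / SC := by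
    rw [SCN_eq] at hfar'
    have : (81 : ℝ) * SC ≤ 4 * (((qPos g.toLK l - qNeg g.toLK l - rad g.toLK l : ℕ) : ℝ)) := by exact_mod_cast hfar'
    rw [Nat.cast_sub hsub, Nat.cast_sub hq] at this
    push_cast
    rw [div_sub_div_same, le_div_iff₀ hS]
    linarith
  have hge : (81 : ℝ) / 4 ≤ ‖latPt G f l.toLab‖ ^ 2 := by rw [hsq]; exact hR.trans hlin.1
  nlinarith [norm_nonneg (latPt G f l.toLab)]



/-- Casting a list sum of integers to reals. [formal bookkeeping] -/
theorem cast_list_sum_int (h : NL → ℤ) : ∀ (T : List NL), (T.map (fun l => ((h l : ℤ) : ℝ))).sum = (((T.map h).sum : ℤ) : ℝ)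
  | [] => by simp
  | l :: T => by rw [List.map_cons, List.map_cons, List.sum_cons, List.sum_cons, cast_list_sum_int h T]; push_cast; ring

/-- Casting a list sum of naturals to reals. [formal bookkeeping] -/
theorem cast_list_sum_nat (h : NL → ℕ) : ∀ (T : List NL), (T.map (fun l => ((h l : ℕ) : ℝ))).sum = (((T.map h).sum : ℕ) : ℝ)
  | [] => by simp
  | l :: T => by rw [List.map_cons, List.map_cons, List.sum_cons, List.sum_cons, cast_list_sum_nat h T]; push_cast; ring

/-- `|sgnZ s m| = m`. [formal bookkeeping] -/
theorem abs_sgnZ (s : Bool) (m : ℕ) : |sgnZ s m| = (m : ℤ) := by cases s <;> simp [sgnZ]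

open Classical in
/-- ONE GRADIENT CLASS: the interval-sum-before-abs bound for a coordinate whose functional `L_l` equals an integer class value `cls l` with
`|cls l| = m l`, given the accumulator identity `GP − GN = Σ_T Dm·cls` and the class-sum bound `Σ_T m ≤ Ac`. [folklore] -/
theorem class_bound {tab : QT} {k : LK} {E : ℕ} (T : List NL) (hTnd : T.Nodup) (L : NL → ℝ) (cls : NL → ℤ) (m : NL → ℕ) (GP GN Ac : ℕ)
    (hL : ∀ l ∈ T, L l = ((cls l : ℤ) : ℝ)) (habs : ∀ l, |cls l| = (m l : ℤ))
    (eG : ((GP : ℕ) : ℤ) - GN = (T.map (fun l => sgnZ (rowT tab k l).sD (rowT tab k l).aD * cls l)).sum) (hAc : (T.map m).sum ≤ Ac) :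
    max |∑ l ∈ T.toFinset, min (((sgnZ (rowT tab k l).sD (rowT tab k l).aD - (E : ℤ) : ℤ) : ℝ) / SC * L l)
          (((sgnZ (rowT tab k l).sD (rowT tab k l).aD + (E : ℤ) : ℤ) : ℝ) / SC * L l)|
        |∑ l ∈ T.toFinset, max (((sgnZ (rowT tab k l).sD (rowT tab k l).aD - (E : ℤ) : ℤ) : ℝ) / SC * L l)
          (((sgnZ (rowT tab k l).sD (rowT tab k l).aD + (E : ℤ) : ℤ) : ℝ) / SC * L l)| ≤
      ((absDiff GP GN + E * Ac : ℕ) : ℝ) / SC := by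
  classical
  have hS := SC_pos
  have hE : (0:ℝ) ≤ (E : ℝ) / SC := div_nonneg (by exact_mod_cast Nat.zero_le E) hS.le
  have hband : ∀ l ∈ T.toFinset,
      min (((sgnZ (rowT tab k l).sD (rowT tab k l).aD - (E : ℤ) : ℤ) : ℝ) / SC * L l)
          (((sgnZ (rowT tab k l).sD (rowT tab k l).aD + (E : ℤ) : ℤ) : ℝ) / SC * L l) =
        ((sgnZ (rowT tab k l).sD (rowT tab k l).aD : ℤ) : ℝ) / SC * L l - (E : ℝ) / SC * |L l| ∧
      max (((sgnZ (rowT tab k l).sD (rowT tab k l).aD - (E : ℤ) : ℤ) : ℝ) / SC * L l)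
          (((sgnZ (rowT tab k l).sD (rowT tab k l).aD + (E : ℤ) : ℤ) : ℝ) / SC * L l) =
        ((sgnZ (rowT tab k l).sD (rowT tab k l).aD : ℤ) : ℝ) / SC * L l + (E : ℝ) / SC * |L l| := by
    intro l _
    have h := min_max_band (((sgnZ (rowT tab k l).sD (rowT tab k l).aD : ℤ) : ℝ) / SC) ((E : ℝ) / SC) (L l) hE
    have e1 : ((sgnZ (rowT tab k l).sD (rowT tab k l).aD - (E : ℤ) : ℤ) : ℝ) / SC =
        ((sgnZ (rowT tab k l).sD (rowT tab k l).aD : ℤ) : ℝ) / SC - (E : ℝ) / SC := by push_cast; ring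
    have e2 : ((sgnZ (rowT tab k l).sD (rowT tab k l).aD + (E : ℤ) : ℤ) : ℝ) / SC =
        ((sgnZ (rowT tab k l).sD (rowT tab k l).aD : ℤ) : ℝ) / SC + (E : ℝ) / SC := by push_cast; ring
    rw [e1, e2]; exact h
  rw [Finset.sum_congr rfl fun l hl => (hband l hl).1, Finset.sum_congr rfl fun l hl => (hband l hl).2,
    Finset.sum_sub_distrib, Finset.sum_add_distrib]
  -- the two sums in closed form
  have hG : ∑ l ∈ T.toFinset, ((sgnZ (rowT tab k l).sD (rowT tab k l).aD : ℤ) : ℝ) / SC * L l = (((GP : ℕ) : ℤ) - GN : ℝ) / SC := by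
    have : ∀ l ∈ T.toFinset, ((sgnZ (rowT tab k l).sD (rowT tab k l).aD : ℤ) : ℝ) / SC * L l =
        ((sgnZ (rowT tab k l).sD (rowT tab k l).aD * cls l : ℤ) : ℝ) / SC := by
      intro l hl; rw [hL l (List.mem_toFinset.1 hl)]; push_cast; ring
    rw [Finset.sum_congr rfl this, ← Finset.sum_div, List.sum_toFinset _ hTnd, cast_list_sum_int, ← eG]; push_cast; rfl
  have hA : ∑ l ∈ T.toFinset, (E : ℝ) / SC * |L l| = (E : ℝ) / SC * (((T.map m).sum : ℕ) : ℝ) := by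
    have : ∀ l ∈ T.toFinset, (E : ℝ) / SC * |L l| = (E : ℝ) / SC * ((m l : ℕ) : ℝ) := by
      intro l hl; rw [hL l (List.mem_toFinset.1 hl)]
      have : |((cls l : ℤ) : ℝ)| = ((m l : ℕ) : ℝ) := by rw [← Int.cast_abs, habs]; push_cast; rfl
      rw [this]
    rw [Finset.sum_congr rfl this, ← Finset.mul_sum, List.sum_toFinset _ hTnd, cast_list_sum_nat]
  rw [hG, hA]
  have hAc' : (((T.map m).sum : ℕ) : ℝ) ≤ Ac := by exact_mod_cast hAc
  have habsG : |(((GP : ℕ) : ℤ) - GN : ℝ)| = ((absDiff GP GN : ℕ) : ℝ) := by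
    have := absDiff_cast GP GN
    have : ((absDiff GP GN : ℕ) : ℝ) = ((|((GP : ℕ) : ℤ) - GN| : ℤ) : ℝ) := by exact_mod_cast this
    rw [this, Int.cast_abs]; push_cast; rfl
  have hnn : 0 ≤ (E : ℝ) / SC * (((T.map m).sum : ℕ) : ℝ) := mul_nonneg hE (by exact_mod_cast Nat.zero_le _)
  have h1 : |(((GP : ℕ) : ℤ) - GN : ℝ) / SC - (E : ℝ) / SC * (((T.map m).sum : ℕ) : ℝ)| ≤
      ((absDiff GP GN : ℕ) : ℝ) / SC + (E : ℝ) / SC * Ac := by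
    refine (abs_sub _ _).trans ?_
    rw [abs_div, habsG, abs_of_pos hS, abs_of_nonneg hnn]
    have := mul_le_mul_of_nonneg_left hAc' hE
    linarith
  have h2 : |(((GP : ℕ) : ℤ) - GN : ℝ) / SC + (E : ℝ) / SC * (((T.map m).sum : ℕ) : ℝ)| ≤
      ((absDiff GP GN : ℕ) : ℝ) / SC + (E : ℝ) / SC * Ac := by
    refine (abs_add_le _ _).trans ?_
    rw [abs_div, habsG, abs_of_pos hS, abs_of_nonneg hnn]
    have := mul_le_mul_of_nonneg_left hAc' hE
    linarith
  have e : ((absDiff GP GN + E * Ac : ℕ) : ℝ) / SC = ((absDiff GP GN : ℕ) : ℝ) / SC + (E : ℝ) / SC * Ac := by push_cast; ring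
  rw [e]
  exact max_le h1 h2


end Summit.AtomisticToContinuum.Crystallization.Theorems.FrustratedLawDichotomyStrainedPatchHomLeafTableCheck

end
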